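/-
Origin: expansion seat `prover-pub-hodgecm-mc-binder-1-g17-0`, handover #R111r2 2026-08-20T22:31:33Z md5 17c2dfecbb6b (159 l.; REPLACE of HodgeCM/Model/TowerRes.lean — PKG file now 1ba2e164adba (163 l., incl. packager Origin header); body of record 3666711eb397 (159 l.) → 17c2dfecbb6b; owner binder-1 #R111 (RUN 63); token strike only: ofLevel_injective/exists_leftInverse_ofLevel/toLevel/res/resTotal/resM/exists_fixed_res_eq … minus h₂; NAMES for audit: HodgeCM.Model.TowerCarrier.resTotal_ofLevel · HodgeCM.Model.TowerCarrier.exists_fixed_res_eq · HodgeCM.Model.TowerCarrier.ofLevel_injective) (`HOME/mc/pub-hodgecm-mc-binder-1-g17/campaign/new/TowerRes.lean`, md5 17c2dfecbb6b, 159 lines);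
landed by the gen-27 packager (p-g27) in gate run 65 REPLACES the earlier landed copy of `HodgeCM/Model/TowerRes.lean` (verbatim).
-/
/-
Copyright (c) 2026 the pub-hodgecm formalisation cell (harness21).  New file, not vendored.
Origin: session prover-pub-hodgecm-mc-binder-1-g16-0 (unit pub-hodgecm-mc-binder-1-g16, BINDER PROVER gen 16 of lineage mc-binder-1;
content lane (J-Liu-Θ), (J3) design memo `HOME/mc/pub-hodgecm-mc-axioms-1-g15/J3-DESIGN.md` §3 + v1.2 `LiuDictionary.res`:
HECKE-TOWER — the identity-component restriction `res Γ : H → H¹(P_Γ; ℂ)` on the tower), 2026-08-20.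
-/
import Summits.HodgeConjecture.HodgeCM.Model.TowerCarrier
import Summits.HodgeConjecture.HodgeCM.Model.TowerInjective
import Mathlib.LinearAlgebra.Basis.VectorSpace

/-!
# `H_K ↪ H` and the identity-component restriction `res Γ : H →ₗ[ℂ] H¹(P_Γ; ℂ)` on the tower

With the transition maps injective (#R110 `TowerInjective.restrictLevel_injective`), the canonical maps
`ofLevel Γ hΓ : H_K → H = colim_K H_K` (#R109) are injective (`ofLevel_injective`: `Module.DirectLimit.of.zero_exact`), so
`H_K = H¹(X_K(ℂ); ℂ)` IS a subspace `levelImage Γ hΓ ≤ H` and the identity-component restriction of #R108 descends to it: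

* `res … Γ hΓ : Tower →ₗ[ℂ] U.CohC (U.pms L ι₁ V Γ) 1` — `TowerLevel.res ∘ (a ℂ-linear left inverse of ofLevel Γ hΓ)`
  (`LinearMap.exists_leftInverse_of_injective`); **`res_ofLevel : res Γ hΓ (ofLevel Γ hΓ c) = TowerLevel.res c`** — on the image of
  `H_K` it is THE restriction to the identity component `P_Γ` (value of the family at the index `1`); off that image it is an arbitrary
  linear extension, as allowed by the dictionary (`J3-DESIGN` §2/§4: only `K`-level vectors are ever read);
* `resTotal … (Γ : Level V)` — the same for EVERY level (junk `0` when `Γ` is not below a conjugate of `K_f(3)`), the shape of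
  `LiuDictionary.res : ∀ Γ : Level V, H →ₗ[ℂ] U.CohC (U.pms L ι₁ V Γ) 1`.

Honesty note (for the desk): Liu's `res` is «`H → H^K = H¹(X_K) → H¹(P_Γ)`»; here it is pinned on `levelImage Γ = image of H¹(X_K(ℂ);ℂ)`,
which consists of `K`-fixed vectors (`TowerCarrier.of_smul_ofLevel_of_mem`); that EVERY `K`-fixed vector of `H` lies in `levelImage Γ`
(`H^K = H¹(X_K)`, transfer for the finite Galois covers `X_{K'} → X_K`) is true and not needed on the E-path (the junction reads `res` only
on the theta families, which are in `levelImage Γ` by construction); it is recorded as the open item (T4)-strong.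
-/

noncomputable section

open Function Set
open NumberField
open Literature.AlgebraicGeometry.Motives
open Literature.AlgebraicGeometry.ShimuraVarieties
open Literature.AlgebraicGeometry.HodgeTheory
open Literature.NumberTheory.Automorphic
open Literature.NumberTheory.Automorphic.PicardCM
open Literature.NumberTheory.Transcendental (Arapura2012_Cor_15_4_6)

namespace HodgeCM.Model.TowerCarrier

open HodgeCM.Model.LevelTranslate HodgeCM.Model.TowerLevel HodgeCM.Model.TowerInjective

variable (hHD : exists_isReal_hodgeModel) (hI : hodgePQ_independent_of_hodgeModel)
  (hU : BallQuotientUniformisedDatum) (h₃ : CMAbelianVarietyRealised) (hA : Arapura2012_Cor_15_4_6)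
variable {L : CMField} {ι₁ : L →+* ℂ} {V : HermSpace3 L ι₁}

/-! ## 1. `H_K ↪ H` -/

/-- **`ofLevel Γ hΓ : H_K → H` is injective** (injective transition maps in a directed system). -/
theorem ofLevel_injective (Γ : Level V) (hΓ : Γ.BelowConjThree) :
    Injective (ofLevel hHD hI hU h₃ hA Γ hΓ) := by
  intro c d hcd
  have h0 : ofLevel hHD hI hU h₃ hA Γ hΓ (c - d) = 0 := by rw [map_sub, hcd, sub_self]
  obtain ⟨j, hij, hj⟩ := Module.DirectLimit.of.zero_exact h0
  have hinj := restrictLevel_injective hHD hI hU h₃ hA (TLvl.le_def.mp hij) hΓ j.2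
  have hcd' : c - d = 0 := hinj (by rw [map_zero]; exact hj)
  exact sub_eq_zero.mp hcd'

/-- **The image of `H_K = H¹(X_K(ℂ); ℂ)` in `H`**, a `ℂ`-subspace (of `K`-fixed vectors, `of_smul_ofLevel_of_mem`). -/
abbrev levelImage (Γ : Level V) (hΓ : Γ.BelowConjThree) : Submodule ℂ (Tower hHD hI hU h₃ hA V) :=
  LinearMap.range (ofLevel hHD hI hU h₃ hA Γ hΓ)

/-- (Ported verbatim from the HodgeCMPerL package; no docstring in the source.) -/
theorem ofLevel_mem_levelImage (Γ : Level V) (hΓ : Γ.BelowConjThree) (c : towerLevel hHD hI hU h₃ hA Γ hΓ) :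
    ofLevel hHD hI hU h₃ hA Γ hΓ c ∈ levelImage hHD hI hU h₃ hA Γ hΓ := ⟨c, rfl⟩

/-- Smaller levels have bigger images: `levelImage Γ ≤ levelImage Γ'` for `Γ' ≤ Γ`. -/
theorem levelImage_mono {Γ Γ' : Level V} (hle : Γ' ≤ Γ) (hΓ : Γ.BelowConjThree) (hΓ' : Γ'.BelowConjThree) :
    levelImage hHD hI hU h₃ hA Γ hΓ ≤ levelImage hHD hI hU h₃ hA Γ' hΓ' := by
  rintro _ ⟨c, rfl⟩
  exact ⟨restrictLevel hHD hI hU h₃ hA hle hΓ hΓ' c, ofLevel_restrictLevel hHD hI hU h₃ hA hle hΓ hΓ' c⟩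

/-- A `ℂ`-linear left inverse of `ofLevel Γ hΓ` (exists by injectivity over a field; a choice). -/
theorem exists_leftInverse_ofLevel (Γ : Level V) (hΓ : Γ.BelowConjThree) :
    ∃ g : Tower hHD hI hU h₃ hA V →ₗ[ℂ] towerLevel hHD hI hU h₃ hA Γ hΓ, g ∘ₗ ofLevel hHD hI hU h₃ hA Γ hΓ = LinearMap.id := by
  have hker : LinearMap.ker (ofLevel hHD hI hU h₃ hA Γ hΓ) = ⊥ :=
    LinearMap.ker_eq_bot_of_injective (ofLevel_injective hHD hI hU h₃ hA Γ hΓ)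
  -- (the `@` form: with `f` passed positionally the elaborator postpones the instance unification on `Tower` and fails)
  obtain ⟨g, hg⟩ := @LinearMap.exists_leftInverse_of_injective ℂ (↥(towerLevel hHD hI hU h₃ hA Γ hΓ)) (Tower hHD hI hU h₃ hA V)
    _ _ _ _ _ (ofLevel hHD hI hU h₃ hA Γ hΓ) hker
  exact ⟨g, hg⟩

/-- The chosen left inverse `H → H_K` of `ofLevel Γ hΓ`. -/
def toLevel (Γ : Level V) (hΓ : Γ.BelowConjThree) :
    Tower hHD hI hU h₃ hA V →ₗ[ℂ] towerLevel hHD hI hU h₃ hA Γ hΓ :=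
  (exists_leftInverse_ofLevel hHD hI hU h₃ hA Γ hΓ).choose

/-- (Ported verbatim from the HodgeCMPerL package; no docstring in the source.) -/
@[simp] theorem toLevel_ofLevel (Γ : Level V) (hΓ : Γ.BelowConjThree)
    (c : towerLevel hHD hI hU h₃ hA Γ hΓ) :
    toLevel hHD hI hU h₃ hA Γ hΓ (ofLevel hHD hI hU h₃ hA Γ hΓ c) = c := by
  have h := (exists_leftInverse_ofLevel hHD hI hU h₃ hA Γ hΓ).choose_spec
  exact congrArg (fun f : towerLevel hHD hI hU h₃ hA Γ hΓ →ₗ[ℂ] towerLevel hHD hI hU h₃ hA Γ hΓ ↦ f c) h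

/-! ## 2. The identity-component restriction on the tower -/

/-- **`res Γ : H →ₗ[ℂ] H¹(P_Γ; ℂ)`** — on the image of `H_K` the restriction to the identity component `P_Γ = U.pms L ι₁ V Γ`
(`TowerLevel.res`), extended linearly. -/
def res (Γ : Level V) (hΓ : Γ.BelowConjThree) :
    Tower hHD hI hU h₃ hA V →ₗ[ℂ] (universeOf hHD hI hU h₃).CohC ((universeOf hHD hI hU h₃).pms L ι₁ V Γ) 1 :=
  TowerLevel.res hHD hI hU h₃ hA ∘ₗ toLevel hHD hI hU h₃ hA Γ hΓ

/-- **On `H_K` the restriction is the value at the identity component.** -/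
@[simp] theorem res_ofLevel (Γ : Level V) (hΓ : Γ.BelowConjThree)
    (c : towerLevel hHD hI hU h₃ hA Γ hΓ) :
    res hHD hI hU h₃ hA Γ hΓ (ofLevel hHD hI hU h₃ hA Γ hΓ c) = TowerLevel.res hHD hI hU h₃ hA c := by
  rw [res, LinearMap.comp_apply, toLevel_ofLevel]

/-- `res` explicitly: for `c ∈ H_K`, `res Γ (ofLevel c) = t_1^* (c 1)` on `P_Γ` (`Γ.conj 1 = Γ`). -/
theorem res_ofLevel_eq (Γ : Level V) (hΓ : Γ.BelowConjThree)
    (c : towerLevel hHD hI hU h₃ hA Γ hΓ) :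
    res hHD hI hU h₃ hA Γ hΓ (ofLevel hHD hI hU h₃ hA Γ hΓ c) =
      trPull hHD hI hU h₃ hA 1 Γ (Γ.conj 1 hΓ) (transCond_one_of_eq (Level.conj_one Γ hΓ).symm) 1
        ((c : Π h, W hHD hI hU h₃ Γ hΓ h) 1) := by
  rw [res_ofLevel, res_apply]

/-- `res` along the tower: for `Γ' ≤ Γ` and `c ∈ H_K`, `res Γ' (ofLevel Γ c) = levelCover^* (res Γ (ofLevel Γ c))`. -/
theorem res_ofLevel_of_le {Γ Γ' : Level V} (hle : Γ' ≤ Γ) (hΓ : Γ.BelowConjThree)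
    (hΓ' : Γ'.BelowConjThree) (c : towerLevel hHD hI hU h₃ hA Γ hΓ) :
    res hHD hI hU h₃ hA Γ' hΓ' (ofLevel hHD hI hU h₃ hA Γ hΓ c) =
      (universeOf hHD hI hU h₃).pullC (X := (universeOf hHD hI hU h₃).pms L ι₁ V Γ')
        (Y := (universeOf hHD hI hU h₃).pms L ι₁ V Γ) (levelCover hU h₃ hHD hA Γ Γ' (Level.Γ_mono hle)) 1
        (res hHD hI hU h₃ hA Γ hΓ (ofLevel hHD hI hU h₃ hA Γ hΓ c)) := by
  rw [res_ofLevel, ← ofLevel_restrictLevel hHD hI hU h₃ hA hle hΓ hΓ' c, res_ofLevel, res_restrictLevel]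

open scoped Classical in
/-- **`res` for EVERY level** (the shape of `LiuDictionary.res`): the restriction above when `Γ` is in the tower's index set, `0` else. -/
def resTotal (Γ : Level V) :
    Tower hHD hI hU h₃ hA V →ₗ[ℂ] (universeOf hHD hI hU h₃).CohC ((universeOf hHD hI hU h₃).pms L ι₁ V Γ) 1 :=
  if hΓ : Γ.BelowConjThree then res hHD hI hU h₃ hA Γ hΓ else 0

/-- (Ported verbatim from the HodgeCMPerL package; no docstring in the source.) -/
theorem resTotal_of (Γ : Level V) (hΓ : Γ.BelowConjThree) :
    resTotal hHD hI hU h₃ hA Γ = res hHD hI hU h₃ hA Γ hΓ := by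
  rw [resTotal, dif_pos hΓ]

/-- (Ported verbatim from the HodgeCMPerL package; no docstring in the source.) -/
@[simp] theorem resTotal_ofLevel (Γ : Level V) (hΓ : Γ.BelowConjThree)
    (c : towerLevel hHD hI hU h₃ hA Γ hΓ) :
    resTotal hHD hI hU h₃ hA Γ (ofLevel hHD hI hU h₃ hA Γ hΓ c) = TowerLevel.res hHD hI hU h₃ hA c := by
  rw [resTotal_of hHD hI hU h₃ hA Γ hΓ, res_ofLevel]

/-- `resTotal` as a map out of the `ℂ[U(V)(𝔸_f)]`-module `TowerModule` (same underlying type). -/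
abbrev resM (Γ : Level V) :
    TowerModule hHD hI hU h₃ hA V →ₗ[ℂ] (universeOf hHD hI hU h₃).CohC ((universeOf hHD hI hU h₃).pms L ι₁ V Γ) 1 :=
  resTotal hHD hI hU h₃ hA Γ

/-- **The junction's `hIso` shape, supplied by the tower**: a family `c ∈ H_K` of component classes whose identity-component value is
`ω` yields a `K`-fixed vector `x ∈ H` in the image of `H¹(X_K)` with `res Γ x = ω`. -/
theorem exists_fixed_res_eq (Γ : Level V) (hΓ : Γ.BelowConjThree)
    (c : towerLevel hHD hI hU h₃ hA Γ hΓ) :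
    ∃ x : TowerModule hHD hI hU h₃ hA V,
      (∀ k ∈ Γ.K, MonoidAlgebra.of ℂ V.adelicFin k • x = x) ∧ x ∈ levelImage hHD hI hU h₃ hA Γ hΓ ∧
        resM hHD hI hU h₃ hA Γ x = TowerLevel.res hHD hI hU h₃ hA c :=
  ⟨ofLevelM hHD hI hU h₃ hA Γ hΓ c, fun _ hk ↦ of_smul_ofLevel_of_mem hHD hI hU h₃ hA hΓ hk c,
    ofLevel_mem_levelImage hHD hI hU h₃ hA Γ hΓ c, resTotal_ofLevel hHD hI hU h₃ hA Γ hΓ c⟩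

end HodgeCM.Model.TowerCarrier

end
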